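import Summits.CriticalPhenomena.PercolationContinuityZ3.Theorems.PercNearOneGluingNoHeavyQuantWindowPerturbLaw
import HarnessLib

/-!
# QUANT lane R8, T-DEC: the PERTURBED WITNESS at a window layer — moving a window-DEC law along ≤ 2 corner segments, ≤ 2 absorber
# points and ≤ 1 leftover low keeps it DEC at an unflipped layer `J`, provided the touched corner quantities stay nonnegative and the
# giant pool of layer `J` absorbs the signed change `Σ tᵢ(cᵢ − u)[hᵢ > J] + Σ sₖ[gₖ > J] − u·r`

builds on p205010 (kernel theorem, internal audit signed; external expert review pending)

Support file (`--supports stmt-CriticalPhenomena-4575`), QUANT lane seat prim-quant-census-2 (gen 57), rung R8 of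
`run/shared/lean/prim/quant/LADDER.md`; memo `run/shared/lean/prim/quant/prim-quant-census-2-g57/WINDOW-ATOMS-G57.md` §2.3 (CLAIM V) / §4
(file H4, part 2).  Theorems only, standard axioms, no sorries.  Part 1 is `…QuantWindowPerturbLaw` (`pertLaw`, `pertMid`, nonnegativity).

* `LawDec.pert_leftover_eq` — the leftover of a low `a ≤ J` of the perturbed mid flow `pertMid` under the perturbed law `pertLaw`:
  `leftover_j a + Σ_{J<b≤j} F a b + [J<h₁]·t₁𝟙[a=l₁] + [J<h₂]·t₂𝟙[a=l₂] + r𝟙[a=l₀]`.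
* **`LawDec.flowAtT_pert`** (memo §2.3, CLAIM V): `0 < x < 1`; `μ ≥ 0` on `{0..M}`; `J ≤ j` with no low mass in `(J, j]`; segments carry
  corner flow, absorber pieces sit on top absorbers `≤ M`, the low piece on a top low of positive mass; (H1) perturbed segment flows, (H2)
  perturbed leftovers, (H3) perturbed residual capacities `≥ 0`; (H5) the pool inequality of layer `J` for the truncated top corner run
  with the signed changes of the pieces lying beyond `J`.  Then `FlowAtT x T J M pertLaw` — by `flowAtT_of_midFlow` with `pertMid`.

[this work]; nothing here is cited as a published result.  The gluing rows served [cite: KozmaNitzan2024, Conjecture 3 (p. 15)]; product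
measure [cite: Grimmett1999, §1.3 p. 10].
-/

noncomputable section

namespace Summit.CriticalPhenomena.PercolationContinuityZ3.Theorems

namespace Quant

open Finset

namespace LawDec

/-- indicator of equality of naturals, as a real number -/
local notation3 "𝟙[" a ", " b "]" => (if (a : ℕ) = (b : ℕ) then (1 : ℝ) else 0)

section Perturb

variable (x T : ℝ) (J j M : ℕ) (μ : ℕ → ℝ) (l₁ h₁ l₂ h₂ g₁ g₂ l₀ : ℕ) (t₁ t₂ s₁ s₂ r : ℝ)

/-- **THE PERTURBED LEFTOVER OF A LOW `a ≤ J`** (no low mass in `(J, j]`; segments carry flow; absorber pieces on top absorbers).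
[this work] -/
theorem pert_leftover_eq (hx0 : 0 < x) (hx1 : x < 1) (hμ : ∀ k, 0 ≤ μ k) (hJ : J ≤ j)
    (hgap : ∀ l, J < l → l ≤ j → 2 * (l : ℝ) < T → μ l = 0)
    (hσ₁ : t₁ ≠ 0 → 0 < cornerMidFlow x T j M μ l₁ h₁) (hσ₂ : t₂ ≠ 0 → 0 < cornerMidFlow x T j M μ l₂ h₂)
    (hg₁ : s₁ ≠ 0 → g₁ ≤ M ∧ ¬ (2 * (g₁ : ℝ) < T ∧ g₁ ≤ j)) (hg₂ : s₂ ≠ 0 → g₂ ≤ M ∧ ¬ (2 * (g₂ : ℝ) < T ∧ g₂ ≤ j))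
    (a : ℕ) (haJ : a ≤ J) (halow : 2 * (a : ℝ) < T) :
    pertLaw x T j μ l₁ h₁ l₂ h₂ g₁ g₂ l₀ t₁ t₂ s₁ s₂ r a
        - ∑ b ∈ Finset.range (M + 1), pertMid x T J j M μ l₁ h₁ l₂ h₂ t₁ t₂ a b
      = (cornerLeftover x T j M μ a
          + ∑ b ∈ Finset.range (M + 1), (if J < b ∧ b ≤ j then cornerMidFlow x T j M μ a b else 0))
        + (if J < h₁ then t₁ * 𝟙[a, l₁] else 0) + (if J < h₂ then t₂ * 𝟙[a, l₂] else 0) + r * 𝟙[a, l₀] := by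
  obtain ⟨h0, hsup, hrow, hcol⟩ := cornerFlow_inv x T j M μ hx0 hx1 hμ ((j + 1) * (j + 1)) le_rfl
  rw [pertLaw_low x T j M μ l₁ h₁ l₂ h₂ g₁ g₂ l₀ t₁ t₂ s₁ s₂ r hx0 hx1 hμ hσ₁ hσ₂ hg₁ hg₂ a ⟨halow, haJ.trans hJ⟩]
  unfold pertMid
  have hm : ∑ b ∈ Finset.range (M + 1),
      (if b ≤ J then cornerMidFlow x T j M μ a b + t₁ * 𝟙[a, l₁] * 𝟙[b, h₁] + t₂ * 𝟙[a, l₂] * 𝟙[b, h₂] else 0)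
      = ∑ b ∈ Finset.range (M + 1), (if b ≤ J then cornerMidFlow x T j M μ a b else 0)
        + ∑ b ∈ Finset.range (M + 1), (if b ≤ J then t₁ * 𝟙[a, l₁] * 𝟙[b, h₁] else 0)
        + ∑ b ∈ Finset.range (M + 1), (if b ≤ J then t₂ * 𝟙[a, l₂] * 𝟙[b, h₂] else 0) := by
    rw [← Finset.sum_add_distrib, ← Finset.sum_add_distrib]
    refine Finset.sum_congr rfl fun b _ => ?_
    split_ifs <;> ring
  have hb1 : ∑ b ∈ Finset.range (M + 1), (if b ≤ J then t₁ * 𝟙[a, l₁] * 𝟙[b, h₁] else 0)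
      = t₁ * 𝟙[a, l₁] - (if J < h₁ then t₁ * 𝟙[a, l₁] else 0) := by
    by_cases ht : t₁ = 0
    · simp [ht]
    · rw [sum_range_bump_le M J a l₁ h₁ t₁ (seg_of_flow_pos x T J j M μ hx0 hx1 hμ hgap l₁ h₁ (hσ₁ ht)).2.2.1]
      by_cases hh : h₁ ≤ J
      · rw [if_pos hh, if_neg (not_lt.2 hh), sub_zero]
      · rw [if_neg hh, if_pos (not_le.1 hh), sub_self]
  have hb2 : ∑ b ∈ Finset.range (M + 1), (if b ≤ J then t₂ * 𝟙[a, l₂] * 𝟙[b, h₂] else 0)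
      = t₂ * 𝟙[a, l₂] - (if J < h₂ then t₂ * 𝟙[a, l₂] else 0) := by
    by_cases ht : t₂ = 0
    · simp [ht]
    · rw [sum_range_bump_le M J a l₂ h₂ t₂ (seg_of_flow_pos x T J j M μ hx0 hx1 hμ hgap l₂ h₂ (hσ₂ ht)).2.2.1]
      by_cases hh : h₂ ≤ J
      · rw [if_pos hh, if_neg (not_lt.2 hh), sub_zero]
      · rw [if_neg hh, if_pos (not_le.1 hh), sub_self]
  have hsplitF : ∑ b ∈ Finset.range (M + 1), cornerMidFlow x T j M μ a b
      = ∑ b ∈ Finset.range (M + 1), (if b ≤ J then cornerMidFlow x T j M μ a b else 0)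
        + ∑ b ∈ Finset.range (M + 1), (if J < b ∧ b ≤ j then cornerMidFlow x T j M μ a b else 0) := by
    rw [← Finset.sum_add_distrib]
    refine Finset.sum_congr rfl fun b _ => ?_
    by_cases hb : b ≤ J
    · rw [if_pos hb, if_neg (fun hc => absurd hb (not_le.2 hc.1)), add_zero]
    · by_cases hbj : b ≤ j
      · rw [if_neg hb, if_pos ⟨not_le.1 hb, hbj⟩, zero_add]
      · rw [if_neg hb, if_neg (fun hc => hbj hc.2), zero_add]
        by_contra hne
        have := (hsup a b hne).2.1
        omega
  have hL : cornerLeftover x T j M μ a = μ a - ∑ b ∈ Finset.range (M + 1), cornerMidFlow x T j M μ a b := rfl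
  rw [hm, hb1, hb2, hL, hsplitF]
  ring

/-- **THE PERTURBED WITNESS AT AN UNFLIPPED WINDOW LAYER** (memo §2.3, CLAIM V). [this work] -/
theorem flowAtT_pert (hx0 : 0 < x) (hx1 : x < 1) (hμ : ∀ k, 0 ≤ μ k) (hJ : J ≤ j)
    (hgap : ∀ l, J < l → l ≤ j → 2 * (l : ℝ) < T → μ l = 0)
    (hσ₁ : t₁ ≠ 0 → 0 < cornerMidFlow x T j M μ l₁ h₁) (hσ₂ : t₂ ≠ 0 → 0 < cornerMidFlow x T j M μ l₂ h₂)
    (hg₁ : s₁ ≠ 0 → g₁ ≤ M ∧ ¬ (2 * (g₁ : ℝ) < T ∧ g₁ ≤ j)) (hg₂ : s₂ ≠ 0 → g₂ ≤ M ∧ ¬ (2 * (g₂ : ℝ) < T ∧ g₂ ≤ j))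
    (hl₀ : r ≠ 0 → 2 * (l₀ : ℝ) < T ∧ l₀ ≤ j ∧ 0 < μ l₀)
    (H1 : ∀ a b, 0 ≤ cornerMidFlow x T j M μ a b + t₁ * 𝟙[a, l₁] * 𝟙[b, h₁] + t₂ * 𝟙[a, l₂] * 𝟙[b, h₂])
    (H2 : ∀ a, 0 ≤ cornerLeftover x T j M μ a + r * 𝟙[a, l₀])
    (H3 : ∀ h, 0 ≤ μ h - ∑ a ∈ Finset.range (j + 1), usage x T j a h * cornerMidFlow x T j M μ a h
      + s₁ * 𝟙[h, g₁] + s₂ * 𝟙[h, g₂])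
    (H5 : x / (1 - x) * (∑ l ∈ (Finset.range (j + 1)).filter (fun l : ℕ => 2 * (l : ℝ) < T),
        (cornerLeftover x T j M μ l + ∑ h ∈ Finset.range (M + 1), (if J < h ∧ h ≤ j then cornerMidFlow x T j M μ l h else 0))
        + (if J < h₁ then t₁ else 0) + (if J < h₂ then t₂ else 0) + r)
      ≤ ∑ h ∈ Finset.Ico (J + 1) (M + 1), μ h
        + (if J < h₁ ∧ h₁ ≤ M then t₁ * usage x T j l₁ h₁ else 0) + (if J < h₂ ∧ h₂ ≤ M then t₂ * usage x T j l₂ h₂ else 0)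
        + (if J < g₁ ∧ g₁ ≤ M then s₁ else 0) + (if J < g₂ ∧ g₂ ≤ M then s₂ else 0)) :
    FlowAtT x T J M (pertLaw x T j μ l₁ h₁ l₂ h₂ g₁ g₂ l₀ t₁ t₂ s₁ s₂ r) := by
  obtain ⟨h0, hsup, hrow, hcol⟩ := cornerFlow_inv x T j M μ hx0 hx1 hμ ((j + 1) * (j + 1)) le_rfl
  have seg₁ := fun ht => seg_of_flow_pos x T J j M μ hx0 hx1 hμ hgap l₁ h₁ (hσ₁ ht)
  have seg₂ := fun ht => seg_of_flow_pos x T J j M μ hx0 hx1 hμ hgap l₂ h₂ (hσ₂ ht)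
  have low₀ : r ≠ 0 → 2 * (l₀ : ℝ) < T ∧ l₀ ≤ j ∧ l₀ ≤ J := fun hr => by
    obtain ⟨q1, q2, q3⟩ := hl₀ hr
    refine ⟨q1, q2, ?_⟩
    by_contra hgt; push Not at hgt
    linarith [hgap l₀ hgt q2 q1]
  -- the perturbed leftovers and their nonnegativity
  have hkey := fun a haJ halow => pert_leftover_eq x T J j M μ l₁ h₁ l₂ h₂ g₁ g₂ l₀ t₁ t₂ s₁ s₂ r hx0 hx1 hμ hJ hgap
    hσ₁ hσ₂ hg₁ hg₂ a haJ halow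
  have hkey0 : ∀ a, 0 ≤ (cornerLeftover x T j M μ a
        + ∑ b ∈ Finset.range (M + 1), (if J < b ∧ b ≤ j then cornerMidFlow x T j M μ a b else 0))
      + (if J < h₁ then t₁ * 𝟙[a, l₁] else 0) + (if J < h₂ then t₂ * 𝟙[a, l₂] else 0) + r * 𝟙[a, l₀] := by
    intro a
    have e1 : (if J < h₁ then t₁ * 𝟙[a, l₁] else 0)
        = ∑ b ∈ Finset.range (M + 1), (if J < b ∧ b ≤ j then t₁ * 𝟙[a, l₁] * 𝟙[b, h₁] else 0) := by
      by_cases ht : t₁ = 0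
      · simp [ht]
      · rw [Finset.sum_eq_single h₁]
        · rw [if_pos (rfl : h₁ = h₁), mul_one]
          by_cases hc : J < h₁
          · rw [if_pos hc, if_pos (show J < h₁ ∧ h₁ ≤ j from ⟨hc, (seg₁ ht).2.2.2.2.2⟩)]
          · rw [if_neg hc, if_neg (fun h => hc h.1)]
        · intro b _ hne; rw [if_neg hne, mul_zero]; split_ifs <;> rfl
        · intro hnot; exact absurd (Finset.mem_range.2 (Nat.lt_succ_of_le (seg₁ ht).2.2.1)) hnot
    have e2 : (if J < h₂ then t₂ * 𝟙[a, l₂] else 0)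
        = ∑ b ∈ Finset.range (M + 1), (if J < b ∧ b ≤ j then t₂ * 𝟙[a, l₂] * 𝟙[b, h₂] else 0) := by
      by_cases ht : t₂ = 0
      · simp [ht]
      · rw [Finset.sum_eq_single h₂]
        · rw [if_pos (rfl : h₂ = h₂), mul_one]
          by_cases hc : J < h₂
          · rw [if_pos hc, if_pos (show J < h₂ ∧ h₂ ≤ j from ⟨hc, (seg₂ ht).2.2.2.2.2⟩)]
          · rw [if_neg hc, if_neg (fun h => hc h.1)]
        · intro b _ hne; rw [if_neg hne, mul_zero]; split_ifs <;> rfl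
        · intro hnot; exact absurd (Finset.mem_range.2 (Nat.lt_succ_of_le (seg₂ ht).2.2.1)) hnot
    have hF : 0 ≤ ∑ b ∈ Finset.range (M + 1), (if J < b ∧ b ≤ j then cornerMidFlow x T j M μ a b else 0)
        + (if J < h₁ then t₁ * 𝟙[a, l₁] else 0) + (if J < h₂ then t₂ * 𝟙[a, l₂] else 0) := by
      rw [e1, e2, ← Finset.sum_add_distrib, ← Finset.sum_add_distrib]
      refine Finset.sum_nonneg fun b _ => ?_
      by_cases hb : J < b ∧ b ≤ j
      · rw [if_pos hb, if_pos hb, if_pos hb]; exact H1 a b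
      · rw [if_neg hb, if_neg hb, if_neg hb]; simp
    have := H2 a
    linarith
  refine flowAtT_of_midFlow x T J M _ (pertMid x T J j M μ l₁ h₁ l₂ h₂ t₁ t₂) hx0 hx1 ?_ ?_ ?_ ?_ ?_ ?_
  · -- (m0)
    intro a b
    unfold pertMid
    by_cases hbJ : b ≤ J
    · rw [if_pos hbJ]; exact H1 a b
    · rw [if_neg hbJ]
  · -- support: the bumps sit on segments, so a nonzero entry has corner flow
    intro a b hne
    unfold pertMid at hne
    by_cases hbJ : b ≤ J
    · rw [if_pos hbJ] at hne
      have hF : cornerMidFlow x T j M μ a b ≠ 0 := by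
        intro hF
        obtain ⟨q1, q2⟩ := bumps_eq_zero_of_flow_eq_zero x T j M μ l₁ h₁ l₂ h₂ t₁ t₂ hσ₁ hσ₂ a b hF
        rw [hF, q1, q2, add_zero, add_zero] at hne
        exact hne rfl
      obtain ⟨-, q3, q4, q5, haJ, -⟩ := seg_of_flow_pos x T J j M μ hx0 hx1 hμ hgap a b (lt_of_le_of_ne (h0 a b) (Ne.symm hF))
      exact ⟨haJ, q3, q4, hbJ, q5⟩
    · rw [if_neg hbJ] at hne; exact absurd rfl hne
  · -- rows: the perturbed leftover is ≥ 0
    intro a haJ halow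
    have := hkey a haJ halow
    have := hkey0 a
    linarith
  · -- mid columns `b ≤ J`
    intro b hbM hbJ hT
    have hnl : ¬ (2 * (b : ℝ) < T ∧ b ≤ j) := fun h => by linarith [h.1]
    rw [pertLaw_abs x T j M μ l₁ h₁ l₂ h₂ g₁ g₂ l₀ t₁ t₂ s₁ s₂ r hx0 hx1 hμ hσ₁ hσ₂ (fun hr => ⟨(hl₀ hr).1, (hl₀ hr).2.1⟩) b hnl]
    unfold pertMid
    simp only [if_pos hbJ]
    have e : ∀ a, usage x T J a b * (cornerMidFlow x T j M μ a b + t₁ * 𝟙[a, l₁] * 𝟙[b, h₁] + t₂ * 𝟙[a, l₂] * 𝟙[b, h₂])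
        = usage x T j a b * cornerMidFlow x T j M μ a b + usage x T j a b * (t₁ * 𝟙[a, l₁] * 𝟙[b, h₁])
          + usage x T j a b * (t₂ * 𝟙[a, l₂] * 𝟙[b, h₂]) := by
      intro a; rw [usage_of_le_layers x T J j a b hbJ (hbJ.trans hJ)]; ring
    simp only [e, Finset.sum_add_distrib]
    -- rows above J of the top run vanish, so the load over range (J+1) is the load over range (j+1)
    have hext : ∑ a ∈ Finset.range (J + 1), usage x T j a b * cornerMidFlow x T j M μ a b
        = ∑ a ∈ Finset.range (j + 1), usage x T j a b * cornerMidFlow x T j M μ a b := by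
      apply Finset.sum_subset (fun a ha => Finset.mem_range.2 (by have := Finset.mem_range.1 ha; omega))
      intro a ha hnot
      have haj : a ≤ j := Nat.lt_succ_iff.1 (Finset.mem_range.1 ha)
      have hJa : J < a := by
        by_contra hle; push Not at hle; exact hnot (Finset.mem_range.2 (Nat.lt_succ_of_le hle))
      by_cases hz : cornerMidFlow x T j M μ a b = 0
      · rw [hz, mul_zero]
      · have := (seg_of_flow_pos x T J j M μ hx0 hx1 hμ hgap a b (lt_of_le_of_ne (h0 a b) (Ne.symm hz))).2.2.2.2.1
        omega
    have e1 : ∑ a ∈ Finset.range (J + 1), usage x T j a b * (t₁ * 𝟙[a, l₁] * 𝟙[b, h₁])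
        = t₁ * (usage x T j l₁ h₁ * 𝟙[b, h₁]) := by
      by_cases ht : t₁ = 0
      · simp [ht]
      · rw [sum_range_usage_bump x T j J l₁ h₁ b t₁ (seg₁ ht).2.2.2.2.1]
        by_cases hb : b = h₁
        · rw [hb, if_pos rfl]; ring
        · rw [if_neg hb]; ring
    have e2 : ∑ a ∈ Finset.range (J + 1), usage x T j a b * (t₂ * 𝟙[a, l₂] * 𝟙[b, h₂])
        = t₂ * (usage x T j l₂ h₂ * 𝟙[b, h₂]) := by
      by_cases ht : t₂ = 0
      · simp [ht]
      · rw [sum_range_usage_bump x T j J l₂ h₂ b t₂ (seg₂ ht).2.2.2.2.1]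
        by_cases hb : b = h₂
        · rw [hb, if_pos rfl]; ring
        · rw [if_neg hb]; ring
    rw [hext, e1, e2]
    have := H3 b
    linarith
  · -- giants nonnegative
    intro b _ _
    exact pertLaw_nonneg x T j M μ l₁ h₁ l₂ h₂ g₁ g₂ l₀ t₁ t₂ s₁ s₂ r hx0 hx1 hμ hσ₁ hσ₂ hg₁ hg₂
      (fun hr => ⟨(hl₀ hr).1, (hl₀ hr).2.1⟩) H1 H2 H3 b
  · -- the pool: evaluate both sides and use (H5)
    have hft₁ : ∑ a ∈ (Finset.range (J + 1)).filter (fun a : ℕ => 2 * (a : ℝ) < T), (if J < h₁ then t₁ * 𝟙[a, l₁] else 0)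
        = if J < h₁ then t₁ else 0 := by
      by_cases ht : t₁ = 0
      · simp [ht]
      · by_cases hc : J < h₁
        · simp only [if_pos hc]; exact sum_filter_range_ind T J l₁ t₁ (seg₁ ht).2.2.2.2.1 (seg₁ ht).2.1
        · simp only [if_neg hc]; exact Finset.sum_const_zero
    have hft₂ : ∑ a ∈ (Finset.range (J + 1)).filter (fun a : ℕ => 2 * (a : ℝ) < T), (if J < h₂ then t₂ * 𝟙[a, l₂] else 0)
        = if J < h₂ then t₂ else 0 := by
      by_cases ht : t₂ = 0
      · simp [ht]
      · by_cases hc : J < h₂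
        · simp only [if_pos hc]; exact sum_filter_range_ind T J l₂ t₂ (seg₂ ht).2.2.2.2.1 (seg₂ ht).2.1
        · simp only [if_neg hc]; exact Finset.sum_const_zero
    have hfr : ∑ a ∈ (Finset.range (J + 1)).filter (fun a : ℕ => 2 * (a : ℝ) < T), r * 𝟙[a, l₀] = r := by
      by_cases hr : r = 0
      · simp [hr]
      · exact sum_filter_range_ind T J l₀ r (low₀ hr).2.2 (low₀ hr).1
    -- the unperturbed part: lows in (J, j] contribute nothing
    have hfJ : ∑ a ∈ (Finset.range (J + 1)).filter (fun a : ℕ => 2 * (a : ℝ) < T),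
          (cornerLeftover x T j M μ a + ∑ b ∈ Finset.range (M + 1), (if J < b ∧ b ≤ j then cornerMidFlow x T j M μ a b else 0))
        = ∑ a ∈ (Finset.range (j + 1)).filter (fun a : ℕ => 2 * (a : ℝ) < T),
          (cornerLeftover x T j M μ a + ∑ b ∈ Finset.range (M + 1), (if J < b ∧ b ≤ j then cornerMidFlow x T j M μ a b else 0)) := by
      apply Finset.sum_subset
      · intro a ha
        obtain ⟨h1, h2⟩ := Finset.mem_filter.1 ha
        exact Finset.mem_filter.2 ⟨Finset.mem_range.2 (by have := Finset.mem_range.1 h1; omega), h2⟩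
      · intro a ha hnot
        obtain ⟨h1, h2⟩ := Finset.mem_filter.1 ha
        have haj : a ≤ j := Nat.lt_succ_iff.1 (Finset.mem_range.1 h1)
        have hJa : J < a := by
          by_contra hle; push Not at hle
          exact hnot (Finset.mem_filter.2 ⟨Finset.mem_range.2 (by omega), h2⟩)
        obtain ⟨q1, q2⟩ := cornerLeftover_eq_zero_of_mass x T j M μ hx0 hx1 hμ a (hgap a hJa haj h2)
        rw [q1, zero_add]
        exact Finset.sum_eq_zero fun b _ => by rw [q2 b]; split_ifs <;> rfl
    have hLHS : ∑ a ∈ (Finset.range (J + 1)).filter (fun a : ℕ => 2 * (a : ℝ) < T),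
          (pertLaw x T j μ l₁ h₁ l₂ h₂ g₁ g₂ l₀ t₁ t₂ s₁ s₂ r a
            - ∑ b ∈ Finset.range (M + 1), pertMid x T J j M μ l₁ h₁ l₂ h₂ t₁ t₂ a b)
        = ∑ a ∈ (Finset.range (j + 1)).filter (fun a : ℕ => 2 * (a : ℝ) < T),
            (cornerLeftover x T j M μ a + ∑ b ∈ Finset.range (M + 1), (if J < b ∧ b ≤ j then cornerMidFlow x T j M μ a b else 0))
          + (if J < h₁ then t₁ else 0) + (if J < h₂ then t₂ else 0) + r := by
      rw [Finset.sum_congr rfl (fun a ha => by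
        obtain ⟨h1, h2⟩ := Finset.mem_filter.1 ha
        exact hkey a (Nat.lt_succ_iff.1 (Finset.mem_range.1 h1)) h2),
        Finset.sum_add_distrib, Finset.sum_add_distrib, Finset.sum_add_distrib, hft₁, hft₂, hfr, hfJ]
    -- the giant side
    have eR : ∀ b, pertLaw x T j μ l₁ h₁ l₂ h₂ g₁ g₂ l₀ t₁ t₂ s₁ s₂ r b
        = μ b + t₁ * 𝟙[b, l₁] + (t₁ * usage x T j l₁ h₁) * 𝟙[b, h₁] + t₂ * 𝟙[b, l₂] + (t₂ * usage x T j l₂ h₂) * 𝟙[b, h₂]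
          + s₁ * 𝟙[b, g₁] + s₂ * 𝟙[b, g₂] + r * 𝟙[b, l₀] := by
      intro b; unfold pertLaw; ring
    have hRHS : ∑ b ∈ Finset.Ico (J + 1) (M + 1), pertLaw x T j μ l₁ h₁ l₂ h₂ g₁ g₂ l₀ t₁ t₂ s₁ s₂ r b
        = ∑ b ∈ Finset.Ico (J + 1) (M + 1), μ b
          + (if J < h₁ ∧ h₁ ≤ M then t₁ * usage x T j l₁ h₁ else 0) + (if J < h₂ ∧ h₂ ≤ M then t₂ * usage x T j l₂ h₂ else 0)
          + (if J < g₁ ∧ g₁ ≤ M then s₁ else 0) + (if J < g₂ ∧ g₂ ≤ M then s₂ else 0) := by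
      simp only [eR, Finset.sum_add_distrib, sum_Ico_ind]
      have w1 : (if J < l₁ ∧ l₁ ≤ M then t₁ else 0) = 0 := by
        by_cases ht : t₁ = 0
        · simp [ht]
        · rw [if_neg (fun hc => by have := (seg₁ ht).2.2.2.2.1; omega)]
      have w2 : (if J < l₂ ∧ l₂ ≤ M then t₂ else 0) = 0 := by
        by_cases ht : t₂ = 0
        · simp [ht]
        · rw [if_neg (fun hc => by have := (seg₂ ht).2.2.2.2.1; omega)]
      have w0 : (if J < l₀ ∧ l₀ ≤ M then r else 0) = 0 := by
        by_cases hr : r = 0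
        · simp [hr]
        · rw [if_neg (fun hc => by have := (low₀ hr).2.2; omega)]
      rw [w1, w2, w0]
      ring
    rw [hLHS, hRHS]
    exact H5

end Perturb

end LawDec

end Quant

end Summit.CriticalPhenomena.PercolationContinuityZ3.Theorems
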